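import Summits.AtomisticToContinuum.HydrodynamicLimit.Theorems.InformationPercolationEngineKickFairRelEquilibriumMesoLongWindowCut
import Summits.AtomisticToContinuum.HydrodynamicLimit.Theorems.InformationPercolationEngineKickFairRelEquilibriumMesoLongReduction
import HarnessLib

/-!
# `KickFairRelEquilibriumMeso`, line `kinetic-window-cut` rev 5 — the glue `stub_longWindowReduction`: B1 → U → SWL → CPL → MesoBody rs

Prover file (`--supports stmt-AtomisticToContinuum-15177`, lead c8) for the registered stub `stub_longWindowReduction` of the checked skeleton
`Cruxes/KickFairRelEquilibriumMeso/Lines/kinetic_window_cut.lean` (rev 5, the LONG-FLIGHT window cut). It is the composition of the two halves landed by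
wave 1: `mesoBody_of_long : SingleKickBias rs → ShortFlightLG → TruncatedFluctuationLong rs → MesoBody rs` (p163594; bias/short/long splitting of the
crux's kick sum, the short part paid by U, Fatou in the index-truncation level) and `truncatedFluctuationLong_of_window : SameWindowPairCovLong rs →
ClosePairCountLong rs → TruncatedFluctuationLong rs` (p163373; the kinetic-window cut with validity events cut to long flights: per-window abstract pair
expansion on the join, far pairs charged `|Γ|`, close pairs counted, Cauchy–Schwarz over the windows). With it the crux body along `rs N = (N+1)^{-1/4}` is
reduced to the four physical stubs B1 (`SingleKickBias`, necessary), U (`ShortFlightLG`), SWL (`SameWindowPairCovLong`), CPL (`ClosePairCountLong`).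
-/

noncomputable section

namespace Summit.AtomisticToContinuum.HydrodynamicLimit.Theorems.KickFairRelEquilibriumMesoLine

open Summit.AtomisticToContinuum.HydrodynamicLimit.Theorems.KickFairRelEquilibriumMesoNegative (MesoBody)

/-- **STUB glue `stub_longWindowReduction` (rev 5 of the line `kinetic-window-cut`).** `B1 → U → SWL → CPL → MesoBody rs`: the window cut turns SWL and CPL
into the truncated long-flight fluctuation statement TFL (`truncatedFluctuationLong_of_window`), and the reduction turns B1, U and TFL into the body of the
crux (`mesoBody_of_long`). [folklore] -/
theorem stub_longWindowReduction :
    SingleKickBias rs → ShortFlightLG → SameWindowPairCovLong rs → ClosePairCountLong rs → MesoBody rs :=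
  fun hB1 hU hSWL hCPL => mesoBody_of_long hB1 hU (truncatedFluctuationLong_of_window hSWL hCPL)

end Summit.AtomisticToContinuum.HydrodynamicLimit.Theorems.KickFairRelEquilibriumMesoLine

end
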